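import Summits.QuantumFields.YangMills.Theorems.BalabanUVNodesN12NearFlatDelta2LetterComponent
import Summits.QuantumFields.YangMills.Theorems.BalabanUVNodesN07LinearisedAveragingKernel
import Summits.QuantumFields.YangMills.Theorems.BalabanUVNodesN12GuardedLinAvgRightInverseGauge
import Literature.MathematicalPhysics.QuantumFieldTheory.Balaban1983to89.Node00.LinearisedAveragingCovariantLocal
import Literature.MathematicalPhysics.QuantumFieldTheory.Balaban1983to89.T4ReflectionConeSharp
import Literature.MathematicalPhysics.QuantumFieldTheory.Balaban1983to89.B5Eq118OneStroke

/-!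
# DAG node N12 [B15] — (P4)′ road, step (T3♯): THE LETTER (δ₂) PER COMPONENT WITH NEAR-FLATNESS ON THE SHARP TOWER ONLY, AND PER-COMPONENT GAUGE COVARIANCE

Cell `pub-ymgap` (HUMAN RULINGS D-0062 ∕ D-0149), width seat `pub-ymgap-dag-n12-w6` g6 = the N12 (P4) clone by row (director-ym R463-ym; target = dag-n12-c's (P4)′ socket
of record, INBOX l.42120).  Key K1⁹ `stmt-QuantumFields-27364`, `--kind proof --supports … --as helper`; count-neutral; THEOREMS ONLY (0 `def`, 0 `sorry`).  Design note
`HOME/pub-ymgap-dag-n12-w6/P4-DESIGN.md`.  (First half of the announced `…N12DirectSurjSiteBlockCurved`, split for the 400-line lint.)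

WHY.  dag-n12-w4's `exists_delta2_letter_component` (p648433) asks near-flatness on `feeds j c` — the window of the abstract locality axiom, which at the `j`-th iterate spills
one block beyond the two-block tower in the positive directions; for the (P4)′ road every row is flattened by ONE axial gauge of the `3^d`-block box around an inner `j`-site,
which [III] (2.13)'s collar places inside `Ω_{j−1}` but NOT the spilled block when `M₁ = 2`.  Bałaban's (0.4) is TWO-BLOCK LOCAL (pv11's
`T4ReflectionConeSharp.twoBlockLocal_blockAvg`); this file iterates that property and re-derives (δ₂) per component under near-flatness on the sharp tower only, then records
the per-component gauge covariance of the chart derivative (the `Ad`-twist by which a curved row is compared with the flat row after a local gauge).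

CONTENTS.  §1 ★ `iter_congr_of_twoBlockLocal`, `avgFamily_congr_sharp`.  §2 ★ `msChart_apply_eq_of_eqOn_sharp_of_fibre`.  §3 ★★★ `exists_delta2_letter_component_sharp` (ONE `C, ρ` per
height; the (δ₂) row `i` under `δ`-near-flatness on the sharp tower of `i` only), `exists_delta2_letter_component_sharp_Bj`.  §4 ★★ `fderiv_msChart_gaugeAct_apply`
(`(DΨ_{W^u,U₀^u}(0)(Ad_{u(b₊)}X))_i = Ad_{ū_j(c₊)} (DΨ_{W,U₀}(0)X)_i`).

HONEST FRAMING.  Composition by name over landed kernel theorems; per-height existence constants (NOT print's volume-uniform `O(1)`); nothing of Bałaban's asserted; N12 NOT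
discharged; K1⁹ NOT closed; count-neutral (typed 28∕28 · discharged 5∕27 unmoved); R4 closes only the conditional finite-`𝕋⁴` rung `BalabanLadder.UV`; the YM mass gap (Clay)
is NOT proved by any of this.
-/

noncomputable section

open scoped BigOperators Matrix.Norms.L2Operator Topology
open Filter Finset

namespace Summit.QuantumFields.YangMills.BalabanUVNodes.N12DirectSurjSharpDelta2

open Literature.MathematicalPhysics.QuantumFieldTheory.Balaban1983to89
open T4Continuum (T4Family)
open T4ReflectionConeSharp (TwoBlockLocal twoBlockLocal_blockAvg)
open BlockAveragingEMLLinearised (linAvg)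
open T4AdjointCovarianceUnitary (lieSU)
open B15DeterminingSets
open B14.Eq213DetSet (Bj)
open B5Eq118OneStroke (iterBlockOf iterBlockOf_zero iterBlockOf_succ)
open Node00
open Literature.MathematicalPhysics.QuantumFieldTheory.Balaban1983to89.Node00 (qLin_gaugeAct_avOfRecord smallBelow_gaugeAct)
open Summit.QuantumFields.YangMills.BalabanUVNodes.N12NearFlatDelta2Letter (exists_delta2_letter exists_guard_of_nearFlat)
open Summit.QuantumFields.YangMills.BalabanUVNodes.N12NearFlatDelta2LetterComponent (fderiv_apply_eq_fderiv_component)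

/-! ## §1  Two-block locality, iterated -/

section Iter

variable {P : Params} {G : Type*} [GaugeGroup G]

/-- ★ **ITERATED TWO-BLOCK LOCALITY**: for a family of two-block-local averaging maps, the `k`-fold average `Ū^k(U)(c)` depends on the fine configuration only through the bonds
`b₀` with BOTH end-points in `B^k(c₋) ∪ B^k(c₊)` (`iterBlockOf k b₀± ∈ {c₋, c₊}`), in the standing range `k ≤ m + K`. [cite: Balaban1987RG1, (0.4) p.253; Balaban1988Convergent, (2.11) p.256] -/
theorem iter_congr_of_twoBlockLocal (av : ∀ j, Averaging P j G) (hav : ∀ j, TwoBlockLocal (av j)) :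
    ∀ (k : ℕ), k ≤ P.m + P.K → ∀ (U U' : GaugeField P 0 G) (c : PBond P k),
      (∀ b₀ : PBond P 0, (iterBlockOf k b₀.src = c.src ∨ iterBlockOf k b₀.src = c.tgt) →
        (iterBlockOf k b₀.tgt = c.src ∨ iterBlockOf k b₀.tgt = c.tgt) → U b₀ = U' b₀) →
      Averaging.iter av k U c = Averaging.iter av k U' c
  | 0, _, U, U', c, h => h c (Or.inl rfl) (Or.inr rfl)
  | k + 1, hk, U, U', c, h => by
    show (av k).avg (Averaging.iter av k U) c = (av k).avg (Averaging.iter av k U') c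
    refine hav k hk _ _ c fun b hbs hbt => iter_congr_of_twoBlockLocal av hav k (Nat.le_of_succ_le hk) U U' b fun b₀ h₀s h₀t => h b₀ ?_ ?_
    · rw [iterBlockOf_succ]
      rcases h₀s with e | e <;> rw [e]
      · exact hbs
      · exact hbt
    · rw [iterBlockOf_succ]
      rcases h₀t with e | e <;> rw [e]
      · exact hbs
      · exact hbt

end Iter

section Record

variable {F : T4Family} {N : ℕ} [NeZero N] {K k : ℕ}

/-- **The averaging of record is two-block local at every level, iterated**: `M˙(U)_j(c) = M˙(U′)_j(c)` when `U = U′` on the fine bonds with both end-points in `B^j(c₋) ∪ B^j(c₊)`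
(`j ≤ m + K`). [cite: Balaban1987RG1, (0.4) p.253; Balaban1988Convergent, (2.11) p.256] -/
theorem avgFamily_congr_sharp {j : ℕ} (hj : j ≤ (F.P K).m + (F.P K).K) {U U' : GaugeField (F.P K) 0 (SU N)} (c : PBond (F.P K) j)
    (h : ∀ b₀ : PBond (F.P K) 0, (iterBlockOf j b₀.src = c.src ∨ iterBlockOf j b₀.src = c.tgt) →
      (iterBlockOf j b₀.tgt = c.src ∨ iterBlockOf j b₀.tgt = c.tgt) → U b₀ = U' b₀) :
    avgFamily (avOfRecord F N K) U j c = avgFamily (avOfRecord F N K) U' j c :=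
  iter_congr_of_twoBlockLocal (avOfRecord F N K) (fun _ => twoBlockLocal_blockAvg _) j hj U U' c h

/-! ## §2  The `i`-th component reads `U` on its sharp tower and `W` at its own index -/

/-- ★ **SHARP COMPONENT IDENTITY**: if `U′ = U₀` on the fine bonds with both end-points in `B^{j_i}(c_{i,−}) ∪ B^{j_i}(c_{i,+})` and `W` is `U₀`'s fibre label on `𝐁`, then for EVERY `X`
`Ψ_{𝐁,W,U₀}(X)_i = Ψ_{𝐁,M˙U′,U′}(X)_i`. [cite: Balaban1988Convergent, (2.10)–(2.11) p.256; Balaban1985Variational, (47) p.285] -/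
theorem msChart_apply_eq_of_eqOn_sharp_of_fibre (hk : k ≤ (F.P K).m + (F.P K).K) {𝔹 : DetSet (F.P K)} {W : MSField (F.P K) (SU N)}
    {U₀ U' : GaugeField (F.P K) 0 (SU N)} (hU : AgreeOn 𝔹 (avgFamily (avOfRecord F N K) U₀) W) (i : Fin (constrCard 𝔹 k))
    (hin : ∀ b₀ : PBond (F.P K) 0,
      (iterBlockOf (((constrEnum 𝔹 k).symm i).1 : ℕ) b₀.src = ((constrEnum 𝔹 k).symm i).2.1.src ∨
        iterBlockOf (((constrEnum 𝔹 k).symm i).1 : ℕ) b₀.src = ((constrEnum 𝔹 k).symm i).2.1.tgt) →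
      (iterBlockOf (((constrEnum 𝔹 k).symm i).1 : ℕ) b₀.tgt = ((constrEnum 𝔹 k).symm i).2.1.src ∨
        iterBlockOf (((constrEnum 𝔹 k).symm i).1 : ℕ) b₀.tgt = ((constrEnum 𝔹 k).symm i).2.1.tgt) → U' b₀ = U₀ b₀)
    (X : PBond (F.P K) 0 → lieSU (Fin N)) :
    msChart F N K k 𝔹 W U₀ X i = msChart F N K k 𝔹 (avgFamily (avOfRecord F N K) U') U' X i := by
  have hj : (((constrEnum 𝔹 k).symm i).1 : ℕ) ≤ (F.P K).m + (F.P K).K := (Nat.le_of_lt_succ ((constrEnum 𝔹 k).symm i).1.2).trans hk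
  have hW : W (((constrEnum 𝔹 k).symm i).1 : ℕ) ((constrEnum 𝔹 k).symm i).2.1
      = avgFamily (avOfRecord F N K) U' (((constrEnum 𝔹 k).symm i).1 : ℕ) ((constrEnum 𝔹 k).symm i).2.1 := by
    rw [← hU _ _ ((constrEnum 𝔹 k).symm i).2.2]
    exact avgFamily_congr_sharp hj _ fun b hs ht => (hin b hs ht).symm
  have hav : avgFamily (avOfRecord F N K) (expChart U₀ X) (((constrEnum 𝔹 k).symm i).1 : ℕ) ((constrEnum 𝔹 k).symm i).2.1
      = avgFamily (avOfRecord F N K) (expChart U' X) (((constrEnum 𝔹 k).symm i).1 : ℕ) ((constrEnum 𝔹 k).symm i).2.1 :=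
    avgFamily_congr_sharp hj _ fun b hs ht => by
      show U₀ b * _ = U' b * _
      rw [hin b hs ht]
  rw [msChart_apply, msChart_apply, relAvg, relAvg, hW, hav]

/-! ## §3  The letter (δ₂) per component, near-flatness on the sharp tower only -/

/-- ★★★ **THE LETTER (δ₂), SHARP COMPONENT EDITION** — ONE `C ≥ 0` and ONE `ρ > 0` per height: for every determining set `𝐁` with no member above `k ≤ m + K`, every datum `W`, every `U₀` IN
THE FIBRE with `Ψ_{𝐁,W,U₀}` differentiable at `0`, every constrained index `i ↔ (j, c)` and every `0 ≤ δ < ρ` with `‖↑U₀_b − 1‖ ≤ δ` on the fine bonds `b` with BOTH END-POINTS in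
`B^j(c₋) ∪ B^j(c₊)`: `‖(DΨ_{𝐁,W,U₀}(0)w)_i − (DΨ_{𝐁,M˙1,1}(0)w)_i‖ ≤ C·δ·p(w)` for every `w`. [cite: Balaban1989LargeFieldII, p.357, (1.12)–(1.13) p.359; Balaban1988Convergent, (2.11)–(2.13) pp.256–257; Balaban1985Variational, (47) p.285, (81)–(83) p.290; Balaban1987RG1, (0.4) p.253] -/
theorem exists_delta2_letter_component_sharp (k : ℕ)
    (Q : (i : ℕ) → (PBond (F.P K) 0 → Matrix (Fin N) (Fin N) ℂ) → PBond (F.P K) i → Matrix (Fin N) (Fin N) ℂ)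
    (hQ0 : ∀ Y, Q 0 Y = Y) (hQs : ∀ (i : ℕ) (Y : PBond (F.P K) 0 → Matrix (Fin N) (Fin N) ℂ) (c : PBond (F.P K) (i + 1)), Q (i + 1) Y c = linAvg (Q i Y) c)
    (p : Seminorm ℝ (PBond (F.P K) 0 → lieSU (Fin N)))
    (hp : ∀ Y : PBond (F.P K) 0 → lieSU (Fin N), ∑ b, ‖(Y b : Matrix (Fin N) (Fin N) ℂ)‖ ^ 2 ≤ p Y ^ 2) :
    ∃ C ρ : ℝ, 0 ≤ C ∧ 0 < ρ ∧
      ∀ (𝔹 : DetSet (F.P K)) (W : MSField (F.P K) (SU N)) (U₀ : GaugeField (F.P K) 0 (SU N)),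
        (∀ j, k < j → 𝔹 j = ∅) → k ≤ (F.P K).m + (F.P K).K →
        AgreeOn 𝔹 (avgFamily (avOfRecord F N K) U₀) W → DifferentiableAt ℝ (msChart F N K k 𝔹 W U₀) 0 →
        ∀ (i : Fin (constrCard 𝔹 k)) ⦃δ : ℝ⦄, 0 ≤ δ → δ < ρ →
        (∀ b₀ : PBond (F.P K) 0,
          (iterBlockOf (((constrEnum 𝔹 k).symm i).1 : ℕ) b₀.src = ((constrEnum 𝔹 k).symm i).2.1.src ∨
            iterBlockOf (((constrEnum 𝔹 k).symm i).1 : ℕ) b₀.src = ((constrEnum 𝔹 k).symm i).2.1.tgt) →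
          (iterBlockOf (((constrEnum 𝔹 k).symm i).1 : ℕ) b₀.tgt = ((constrEnum 𝔹 k).symm i).2.1.src ∨
            iterBlockOf (((constrEnum 𝔹 k).symm i).1 : ℕ) b₀.tgt = ((constrEnum 𝔹 k).symm i).2.1.tgt) →
          ‖((U₀ b₀ : SU N) : Matrix (Fin N) (Fin N) ℂ) - 1‖ ≤ δ) →
        ∀ w : PBond (F.P K) 0 → lieSU (Fin N),
          ‖fderiv ℝ (msChart F N K k 𝔹 W U₀) 0 w i
              - fderiv ℝ (msChart F N K k 𝔹 (avgFamily (avOfRecord F N K) (1 : GaugeField (F.P K) 0 (SU N))) (1 : GaugeField (F.P K) 0 (SU N))) 0 w i‖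
            ≤ C * δ * p w := by
  obtain ⟨C, ρ₁, hC, hρ₁, h⟩ := exists_delta2_letter (F := F) (N := N) (K := K) k Q hQ0 hQs p hp
  obtain ⟨t₀, ρg, ht₀, hst, hρg, hguard⟩ := exists_guard_of_nearFlat (F := F) (N := N) K k
  obtain ⟨_, ρ'', _, hρ'', hsb, _⟩ := exists_uniform_chartCurvature_sq_bound (F := F) (N := N) (K := K) k
  refine ⟨C, min ρ₁ (min ρg ρ''), hC, lt_min hρ₁ (lt_min hρg hρ''), fun 𝔹 W U₀ _ hk hU hΨ i δ hδ0 hδρ hloc w => ?_⟩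
  -- the proxy: `U₀` on the sharp tower, `1` elsewhere
  let S : Set (PBond (F.P K) 0) := {b₀ |
    (iterBlockOf (((constrEnum 𝔹 k).symm i).1 : ℕ) b₀.src = ((constrEnum 𝔹 k).symm i).2.1.src ∨
      iterBlockOf (((constrEnum 𝔹 k).symm i).1 : ℕ) b₀.src = ((constrEnum 𝔹 k).symm i).2.1.tgt) ∧
    (iterBlockOf (((constrEnum 𝔹 k).symm i).1 : ℕ) b₀.tgt = ((constrEnum 𝔹 k).symm i).2.1.src ∨
      iterBlockOf (((constrEnum 𝔹 k).symm i).1 : ℕ) b₀.tgt = ((constrEnum 𝔹 k).symm i).2.1.tgt)}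
  obtain ⟨U', hin, hflat⟩ := Node00.exists_nearFlat_eqOn U₀ S hδ0 fun b hb => hloc b hb.1 hb.2
  have hρ1 : δ < ρ₁ := lt_of_lt_of_le hδρ (min_le_left _ _)
  have hρ2 : δ ≤ ρg := (le_of_lt hδρ).trans ((min_le_right _ _).trans (min_le_left _ _))
  have hρ3 : δ ≤ ρ'' := (le_of_lt hδρ).trans ((min_le_right _ _).trans (min_le_right _ _))
  have hg : ∀ i', i' < k → PlaqSmall t₀ (Averaging.iter (avOfRecord F N K) i' U') := fun i' hi' => hguard U' (hflat.trans hρ2) i' hi'.le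
  have hlt : ‖coeField U' - 1‖ < ρ₁ := lt_of_le_of_lt hflat hρ1
  have hAgr : AgreeOn 𝔹 (avgFamily (avOfRecord F N K) U') (avgFamily (avOfRecord F N K) U') := fun _ _ _ => rfl
  -- the global letter at the proxy in its own fibre
  have key := h ht₀ hst U' 𝔹 (avgFamily (avOfRecord F N K) U') hg hlt hAgr w
  have keyi : ‖fderiv ℝ (msChart F N K k 𝔹 (avgFamily (avOfRecord F N K) U') U') 0 w i
      - fderiv ℝ (msChart F N K k 𝔹 (avgFamily (avOfRecord F N K) (1 : GaugeField (F.P K) 0 (SU N))) (1 : GaugeField (F.P K) 0 (SU N))) 0 w i‖ ≤ C * δ * p w := by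
    rw [← Pi.sub_apply]
    exact (norm_le_pi_norm _ i).trans (key.trans (mul_le_mul_of_nonneg_right (mul_le_mul_of_nonneg_left hflat hC) (apply_nonneg p w)))
  -- the sharp component identity `(DΨ_{W,U₀}(0)w)_i = (DΨ_{M˙U′,U′}(0)w)_i`
  have hΨ' : DifferentiableAt ℝ (msChart F N K k 𝔹 (avgFamily (avOfRecord F N K) U') U') 0 := differentiableAt_msChart hAgr (hsb U' (hflat.trans hρ3))
  have hfun : (fun X => msChart F N K k 𝔹 W U₀ X i) = fun X => msChart F N K k 𝔹 (avgFamily (avOfRecord F N K) U') U' X i :=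
    funext fun X => msChart_apply_eq_of_eqOn_sharp_of_fibre hk hU i (fun b hs ht => hin b ⟨hs, ht⟩) X
  have hcomp : fderiv ℝ (msChart F N K k 𝔹 W U₀) 0 w i = fderiv ℝ (msChart F N K k 𝔹 (avgFamily (avOfRecord F N K) U') U') 0 w i := by
    rw [fderiv_apply_eq_fderiv_component hΨ, fderiv_apply_eq_fderiv_component hΨ', hfun]
  rw [hcomp]
  exact keyi

/-- ★★ **THE SAME AT THE RECORD's DETERMINING SET `𝐁_k(Z) = Bj M₁ Z k`** (no member above `k`): the (δ₂) row `i` of the direct road with near-flatness of `U₀` asked only on the sharp tower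
of that row. [cite: Balaban1989LargeFieldII, p.357, (1.12) p.359; Balaban1988Convergent, (2.11)–(2.13) pp.256–257; Balaban1987RG1, (0.4) p.253] -/
theorem exists_delta2_letter_component_sharp_Bj (k M₁ : ℕ) (Z : Set (Site (F.P K) 0))
    (Q : (i : ℕ) → (PBond (F.P K) 0 → Matrix (Fin N) (Fin N) ℂ) → PBond (F.P K) i → Matrix (Fin N) (Fin N) ℂ)
    (hQ0 : ∀ Y, Q 0 Y = Y) (hQs : ∀ (i : ℕ) (Y : PBond (F.P K) 0 → Matrix (Fin N) (Fin N) ℂ) (c : PBond (F.P K) (i + 1)), Q (i + 1) Y c = linAvg (Q i Y) c)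
    (p : Seminorm ℝ (PBond (F.P K) 0 → lieSU (Fin N)))
    (hp : ∀ Y : PBond (F.P K) 0 → lieSU (Fin N), ∑ b, ‖(Y b : Matrix (Fin N) (Fin N) ℂ)‖ ^ 2 ≤ p Y ^ 2) :
    ∃ C ρ : ℝ, 0 ≤ C ∧ 0 < ρ ∧
      ∀ (W : MSField (F.P K) (SU N)) (U₀ : GaugeField (F.P K) 0 (SU N)), k ≤ (F.P K).m + (F.P K).K →
        AgreeOn (Bj M₁ Z k) (avgFamily (avOfRecord F N K) U₀) W → DifferentiableAt ℝ (msChart F N K k (Bj M₁ Z k) W U₀) 0 →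
        ∀ (i : Fin (constrCard (Bj M₁ Z k) k)) ⦃δ : ℝ⦄, 0 ≤ δ → δ < ρ →
        (∀ b₀ : PBond (F.P K) 0,
          (iterBlockOf (((constrEnum (Bj M₁ Z k) k).symm i).1 : ℕ) b₀.src = ((constrEnum (Bj M₁ Z k) k).symm i).2.1.src ∨
            iterBlockOf (((constrEnum (Bj M₁ Z k) k).symm i).1 : ℕ) b₀.src = ((constrEnum (Bj M₁ Z k) k).symm i).2.1.tgt) →
          (iterBlockOf (((constrEnum (Bj M₁ Z k) k).symm i).1 : ℕ) b₀.tgt = ((constrEnum (Bj M₁ Z k) k).symm i).2.1.src ∨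
            iterBlockOf (((constrEnum (Bj M₁ Z k) k).symm i).1 : ℕ) b₀.tgt = ((constrEnum (Bj M₁ Z k) k).symm i).2.1.tgt) →
          ‖((U₀ b₀ : SU N) : Matrix (Fin N) (Fin N) ℂ) - 1‖ ≤ δ) →
        ∀ w : PBond (F.P K) 0 → lieSU (Fin N),
          ‖fderiv ℝ (msChart F N K k (Bj M₁ Z k) W U₀) 0 w i
              - fderiv ℝ (msChart F N K k (Bj M₁ Z k) (avgFamily (avOfRecord F N K) (1 : GaugeField (F.P K) 0 (SU N))) (1 : GaugeField (F.P K) 0 (SU N))) 0 w i‖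
            ≤ C * δ * p w := by
  obtain ⟨C, ρ, hC, hρ, h⟩ := exists_delta2_letter_component_sharp (F := F) (N := N) (K := K) k Q hQ0 hQs p hp
  exact ⟨C, ρ, hC, hρ, fun W U₀ hk hU hΨ i δ hδ0 hδρ hloc w => h (Bj M₁ Z k) W U₀ (fun _ hj => B14.Eq213DetSet.Bj_of_gt hj) hk hU hΨ i hδ0 hδρ hloc w⟩

/-! ## §4  Per-component gauge covariance of the chart derivative -/

/-- ★ **GAUGE COVARIANCE OF THE CHART DERIVATIVE, COMPONENT BY COMPONENT.**  For a fine gauge transformation `u`, `U₀` in the fibre of `W` on `𝐁` (no member above `k ≤ m + K`) with the guard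
below `k`: the chart at the transformed pair (`U₀^u`, `W^u := (u↾_j)(c₋)·W_j(c)·(u↾_j)(c₊)⁻¹`) applied to the transformed direction `b ↦ Ad(u(b₊))X_b` has `i`-th component
`Ad((u↾_{j_i})(c_{i,+}))` of the `i`-th component of `DΨ_{𝐁,W,U₀}(0)X` (n07-w1's `qLin_gaugeAct` read through `coe_fderiv_msChart_apply_eq_qLin`).
[cite: Balaban1985Variational, (153) p.301, (44)-(47) p.285; Balaban1985Averaging, (11) p.19; Balaban1989LargeFieldII, (1.25) p.362] -/
theorem fderiv_msChart_gaugeAct_apply {𝔹 : DetSet (F.P K)} (h𝔹 : ∀ j, k < j → 𝔹 j = ∅) (hk : k ≤ (F.P K).m + (F.P K).K) (u : GaugeTransf (F.P K) 0 (SU N))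
    {W : MSField (F.P K) (SU N)} {U₀ : GaugeField (F.P K) 0 (SU N)} (hU : AgreeOn 𝔹 (avgFamily (avOfRecord F N K) U₀) W) (hsb : SmallBelow (avOfRecord F N K) k U₀)
    (X : PBond (F.P K) 0 → lieSU (Fin N)) (i : Fin (constrCard 𝔹 k)) :
    fderiv ℝ (msChart F N K k 𝔹 (fun j c => B16Sect1Backgrounds.toMS u j c.src * W j c * (B16Sect1Backgrounds.toMS u j c.tgt)⁻¹) (GaugeField.gaugeAct u U₀)) 0
        (fun b => T4AdjointCovarianceUnitary.specialUnitaryAd (u b.tgt) (X b)) i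
      = T4AdjointCovarianceUnitary.specialUnitaryAd (B16Sect1Backgrounds.toMS u (((constrEnum 𝔹 k).symm i).1 : ℕ) ((constrEnum 𝔹 k).symm i).2.1.tgt)
          (fderiv ℝ (msChart F N K k 𝔹 W U₀) 0 X i) := by
  have hsbu : SmallBelow (avOfRecord F N K) k (GaugeField.gaugeAct u U₀) := smallBelow_gaugeAct (P := F.P K) hk u hsb
  have hUu : AgreeOn 𝔹 (avgFamily (avOfRecord F N K) (GaugeField.gaugeAct u U₀))
      (fun j c => B16Sect1Backgrounds.toMS u j c.src * W j c * (B16Sect1Backgrounds.toMS u j c.tgt)⁻¹) := by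
    intro j c hc
    by_cases hj : j ≤ k
    · show Averaging.iter (avOfRecord F N K) j (GaugeField.gaugeAct u U₀) c = _
      rw [B16Sect1Backgrounds.iter_gaugeAct (avOfRecord F N K) u U₀ j (hj.trans hk)]
      show B16Sect1Backgrounds.toMS u j c.src * Averaging.iter (avOfRecord F N K) j U₀ c * (B16Sect1Backgrounds.toMS u j c.tgt)⁻¹ = _
      rw [show Averaging.iter (avOfRecord F N K) j U₀ c = W j c from hU j c hc]
    · exfalso
      rw [h𝔹 j (lt_of_not_ge hj)] at hc
      simp [bondsOf] at hc
  have hj : (((constrEnum 𝔹 k).symm i).1 : ℕ) ≤ k := Nat.le_of_lt_succ ((constrEnum 𝔹 k).symm i).1.2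
  apply Subtype.ext
  rw [Summit.QuantumFields.YangMills.BalabanUVNodes.N07LinearisedAveragingKernel.coe_fderiv_msChart_apply_eq_qLin hUu hsbu,
    T4AdjointCovarianceUnitary.coe_specialUnitaryAd,
    Summit.QuantumFields.YangMills.BalabanUVNodes.N07LinearisedAveragingKernel.coe_fderiv_msChart_apply_eq_qLin hU hsb,
    qLin_gaugeAct_avOfRecord (hj.trans hk) u (hsb.mono hj) X]

end Record

end Summit.QuantumFields.YangMills.BalabanUVNodes.N12DirectSurjSharpDelta2
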